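import Mathlib
import HarnessLib
import Summits.KontsevichZagierPeriods.Zeta5Search.Denom.CatalanRayPClosed

/-!
# CatalanRayPClosedOdd — Theorem K6 (odd primes) for the explicit rational part of the slid Catalan-ray forms (cell `pub-zeta5`, fam-denom D9)
HONEST FRAMING: systematic search; no irrationality claim unless certified.  This file is denominator arithmetic of
an explicit finite sum of rationals; it makes no statement about irrationality.

Continuation of `Denom/CatalanRayPClosed.lean` (its module docstring states the representation and the full theorem
list): the blocks of the pole families β (`T = −a`, `1 ≤ a ≤ n`, double) and γ (`n < a ≤ 2n`, simple), the term
valuations as the level sums `vAlpha/vBeta/vGamma` of `CatalanRayDigitsC` plus atoms, the fourth atom lemma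
`logDer_padicValRat_ge : v_p(Λ_a) ≥ −⌊log_p(2(a+J)−1)⌋`, and the assembly
**`PClosed_oddInt (3n ≤ J) (1 ≤ n) (p odd prime) : −(⌊log_p(J+n)⌋ + ⌊log_p max(J,4n−1)⌋) ≤ v_p(PClosed n J)`**,
**`rayPClosed_oddInt (j ≥ 3) (n ≥ 1)`** — Theorem K6 of `families/denom/CATK6.md` for the explicit closed form (the
bound is attained: `v₃(PClosed 1 3) = −2`).  Inputs by name: `termAlpha/termBetaB/termBetaA/termGamma`
(`CatalanRayDigitsC`), `gsumAtom/Watom/sigmaAtom_padicValRat_ge`, `le_padicValRat_sum` (`CatalanRayAtoms`); terms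
with a vanishing atom factor are `0` and need no bound.
NOT typed: the identification of `PClosed n (jn)` with the remainder `P_n` of `Jsym` (see the first file).
-/

namespace Summit.KontsevichZagierPeriods.Zeta5Search.Denom.CatalanRayPClosed

open Finset
open Summit.KontsevichZagierPeriods.Zeta5Search.Denom.CatalanRayAtoms
open Summit.KontsevichZagierPeriods.Zeta5Search.Denom.CatalanRayDigits

/-! ### Families β and γ (poles at `T = −a`): blocks -/

/-- the numerator at a pole `T = −a` does not vanish. -/
theorem Nnum_neg_ne (n J a : ℕ) : Nnum n J (-(a : ℚ)) ≠ 0 := by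
  unfold Nnum
  refine Finset.prod_ne_zero_iff.mpr (fun i _ => ?_)
  intro h
  have h1 : (2 : ℚ) * (i : ℕ) + 1 = 2 * ((a + J : ℕ) : ℚ) := by push_cast at h ⊢; linarith
  have h2 : 2 * i + 1 = 2 * (a + J) := by exact_mod_cast h1
  omega

/-- β (`a ≤ n`): `v_p(N(−a)) = [v_p((2X)!) − v_p(X!)] + [v_p((2(n−a))!) − v_p((n−a)!)]`, `X = a + J`. -/
theorem v_Nnum_beta {p : ℕ} [Fact p.Prime] (hp2 : p ≠ 2) (n J a : ℕ) (ha : a ≤ n) :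
    padicValRat p (Nnum n J (-(a : ℚ)))
      = (vf p (2 * (a + J)) - vf p (a + J)) + (vf p (2 * (n - a)) - vf p (n - a)) := by
  obtain ⟨r, rfl⟩ : ∃ r, n = a + r := ⟨n - a, by omega⟩
  rw [show a + r - a = r by omega]
  unfold Nnum
  rw [← padicValRat_prod (fun i hi => (Finset.prod_ne_zero_iff.mp (Nnum_neg_ne (a + r) J a)) i hi),
    show J + (a + r) = (a + J) + r by ring, Finset.sum_range_add, ← oddBlock p hp2 (a + J), ← oddBlock p hp2 r,
    ← Finset.sum_range_reflect (fun i => ((padicValNat p (2 * i + 1) : ℕ) : ℤ)) (a + J)]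
  congr 1
  · refine Finset.sum_congr rfl (fun i hi => ?_)
    rw [Finset.mem_range] at hi
    obtain ⟨k, hk⟩ : ∃ k, a + J = i + k + 1 := ⟨a + J - 1 - i, by omega⟩
    have hk' : (a : ℚ) + J = i + k + 1 := by exact_mod_cast hk
    rw [show a + J - 1 - i = k by omega,
      show -(a : ℚ) - (J : ℚ) + 1 / 2 + (i : ℕ) = -(((2 * k + 1 : ℕ) : ℚ) / 2) by push_cast; linarith]
    exact v_halfodd_neg hp2 _
  · refine Finset.sum_congr rfl (fun i _ => ?_)
    rw [show -(a : ℚ) - (J : ℚ) + 1 / 2 + ((a + J + i : ℕ) : ℚ) = ((2 * i + 1 : ℕ) : ℚ) / 2 by push_cast; ring]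
    exact v_halfodd_pos hp2 _

/-- γ (`n < a`): `v_p(N(−a)) = [v_p((2X)!) − v_p(X!)] − [v_p((2(a−n))!) − v_p((a−n)!)]`. -/
theorem v_Nnum_gamma {p : ℕ} [Fact p.Prime] (hp2 : p ≠ 2) (n J a : ℕ) (hna : n < a) :
    padicValRat p (Nnum n J (-(a : ℚ)))
      = (vf p (2 * (a + J)) - vf p (a + J)) - (vf p (2 * (a - n)) - vf p (a - n)) := by
  obtain ⟨r, rfl⟩ : ∃ r, a = n + r := ⟨a - n, by omega⟩
  rw [show n + r - n = r by omega]
  unfold Nnum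
  rw [← padicValRat_prod (fun i hi => (Finset.prod_ne_zero_iff.mp (Nnum_neg_ne n J (n + r))) i hi),
    ← Finset.sum_range_reflect (fun i => padicValRat p (-((n + r : ℕ) : ℚ) - (J : ℚ) + 1 / 2 + (i : ℕ))) (J + n)]
  have h := oddBlock p hp2 (r + (J + n))
  rw [Finset.sum_range_add, oddBlock p hp2 r] at h
  have hs : ∑ j ∈ range (J + n), padicValRat p (-((n + r : ℕ) : ℚ) - (J : ℚ) + 1 / 2 + ((J + n - 1 - j : ℕ) : ℚ))
      = ∑ i ∈ range (J + n), ((padicValNat p (2 * (r + i) + 1) : ℕ) : ℤ) := by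
    refine Finset.sum_congr rfl (fun i hi => ?_)
    rw [Finset.mem_range] at hi
    obtain ⟨k, hk⟩ : ∃ k, J + n = i + k + 1 := ⟨J + n - 1 - i, by omega⟩
    have hk' : (J : ℚ) + n = i + k + 1 := by exact_mod_cast hk
    rw [show J + n - 1 - i = k by omega,
      show -((n + r : ℕ) : ℚ) - (J : ℚ) + 1 / 2 + (k : ℕ) = -(((2 * (r + i) + 1 : ℕ) : ℚ) / 2) by push_cast; linarith]
    exact v_halfodd_neg hp2 _
  rw [hs]
  rw [show r + (J + n) = n + r + J by ring] at h
  linarith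

/-- β (`a ≤ n ≤ a + J`): `v_p(D1(−a)) = v_p((X−n)!) + v_p((n−a)!)`. -/
theorem v_D1_beta {p : ℕ} [Fact p.Prime] (n J a : ℕ) (ha : a ≤ n) (hn : n ≤ a + J) :
    padicValRat p (D1 n J (-(a : ℚ))) = vf p (a + J - n) + vf p (n - a) := by
  obtain ⟨r, rfl⟩ : ∃ r, n = a + r := ⟨n - a, by omega⟩
  obtain ⟨s, rfl⟩ : ∃ s, J = r + s := ⟨J - r, by omega⟩
  rw [show a + (r + s) - (a + r) = s by omega, show a + r - a = r by omega]
  unfold D1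
  rw [← padicValRat_prod (fun _ _ => skip_ne _), show r + s + 1 = s + (1 + r) by ring,
    Finset.sum_range_add, Finset.sum_range_add, ← intBlock p s, ← intBlock p r,
    ← Finset.sum_range_reflect (fun i => ((padicValNat p (i + 1) : ℕ) : ℤ)) s]
  have hmid : padicValRat p (skip (-(a : ℚ) - ((r + s : ℕ) : ℚ) + ((a + r : ℕ) : ℚ) + ((s + 0 : ℕ) : ℚ))) = 0 := by
    rw [show (-(a : ℚ) - ((r + s : ℕ) : ℚ) + ((a + r : ℕ) : ℚ) + ((s + 0 : ℕ) : ℚ)) = 0 by push_cast; ring]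
    simp [skip]
  rw [Finset.sum_range_one, hmid, zero_add]
  congr 1
  · refine Finset.sum_congr rfl (fun i hi => ?_)
    rw [Finset.mem_range] at hi
    obtain ⟨k, hk⟩ : ∃ k, s = i + k + 1 := ⟨s - 1 - i, by omega⟩
    rw [show s - 1 - i = k by omega,
      show -(a : ℚ) - ((r + s : ℕ) : ℚ) + ((a + r : ℕ) : ℚ) + (i : ℕ) = -(((k + 1 : ℕ) : ℚ)) by rw [hk]; push_cast; ring,
      skip, if_neg (neg_ne_zero.mpr (by positivity))]
    exact v_negnat _
  · refine Finset.sum_congr rfl (fun i _ => ?_)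
    rw [show -(a : ℚ) - ((r + s : ℕ) : ℚ) + ((a + r : ℕ) : ℚ) + ((s + (1 + i) : ℕ) : ℚ) = ((i + 1 : ℕ) : ℚ) by push_cast; ring,
      skip, if_neg (by positivity)]
    exact padicValRat.of_nat

/-- γ (`n < a`): `v_p(D1(−a)) = v_p((X−n)!) − v_p((a−n−1)!)`. -/
theorem v_D1_gamma {p : ℕ} [Fact p.Prime] (n J a : ℕ) (hna : n < a) :
    padicValRat p (D1 n J (-(a : ℚ))) = vf p (a + J - n) - vf p (a - n - 1) := by
  obtain ⟨r, rfl⟩ : ∃ r, a = n + r + 1 := ⟨a - n - 1, by omega⟩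
  rw [show n + r + 1 + J - n = r + (J + 1) by omega, show n + r + 1 - n - 1 = r by omega]
  unfold D1
  rw [← padicValRat_prod (fun _ _ => skip_ne _),
    ← Finset.sum_range_reflect
      (fun i => padicValRat p (skip (-((n + r + 1 : ℕ) : ℚ) - (J : ℚ) + (n : ℚ) + (i : ℕ)))) (J + 1)]
  have h := intBlock p (r + (J + 1))
  rw [Finset.sum_range_add, intBlock p r] at h
  have hs : ∑ j ∈ range (J + 1), padicValRat p (skip (-((n + r + 1 : ℕ) : ℚ) - (J : ℚ) + (n : ℚ) + ((J + 1 - 1 - j : ℕ) : ℚ)))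
      = ∑ i ∈ range (J + 1), ((padicValNat p (r + i + 1) : ℕ) : ℤ) := by
    refine Finset.sum_congr rfl (fun i hi => ?_)
    rw [Finset.mem_range] at hi
    obtain ⟨k, hk⟩ : ∃ k, J = i + k := ⟨J - i, by omega⟩
    rw [show J + 1 - 1 - i = k by omega,
      show -((n + r + 1 : ℕ) : ℚ) - (J : ℚ) + (n : ℚ) + (k : ℕ) = -(((r + i + 1 : ℕ) : ℚ)) by rw [hk]; push_cast; ring,
      skip, if_neg (neg_ne_zero.mpr (by positivity))]
    exact v_negnat _
  rw [hs]; linarith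

/-- β/γ (`1 ≤ a ≤ 2n`): `v_p(D2(−a)) = v_p((a−1)!) + v_p((2n−a)!)`. -/
theorem v_D2_neg {p : ℕ} [Fact p.Prime] (n a : ℕ) (ha1 : 1 ≤ a) (ha2 : a ≤ 2 * n) :
    padicValRat p (D2 n (-(a : ℚ))) = vf p (a - 1) + vf p (2 * n - a) := by
  obtain ⟨b, rfl⟩ : ∃ b, a = b + 1 := ⟨a - 1, by omega⟩
  obtain ⟨t, ht⟩ : ∃ t, 2 * n = b + (1 + t) := ⟨2 * n - b - 1, by omega⟩
  rw [show b + 1 - 1 = b by omega, show 2 * n - (b + 1) = t by omega]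
  unfold D2
  rw [← padicValRat_prod (fun _ _ => skip_ne _), ht, Finset.sum_range_add, Finset.sum_range_add,
    ← intBlock p b, ← intBlock p t, ← Finset.sum_range_reflect (fun i => ((padicValNat p (i + 1) : ℕ) : ℤ)) b]
  have hmid : padicValRat p (skip (-((b + 1 : ℕ) : ℚ) + ((b + 0 : ℕ) : ℚ) + 1)) = 0 := by
    rw [show (-((b + 1 : ℕ) : ℚ) + ((b + 0 : ℕ) : ℚ) + 1) = 0 by push_cast; ring]
    simp [skip]
  rw [Finset.sum_range_one, hmid, zero_add]
  congr 1
  · refine Finset.sum_congr rfl (fun i hi => ?_)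
    rw [Finset.mem_range] at hi
    obtain ⟨k, hk⟩ : ∃ k, b = i + k + 1 := ⟨b - 1 - i, by omega⟩
    rw [show b - 1 - i = k by omega,
      show -((b + 1 : ℕ) : ℚ) + (i : ℕ) + 1 = -(((k + 1 : ℕ) : ℚ)) by rw [hk]; push_cast; ring,
      skip, if_neg (neg_ne_zero.mpr (by positivity))]
    exact v_negnat _
  · refine Finset.sum_congr rfl (fun i _ => ?_)
    rw [show -((b + 1 : ℕ) : ℚ) + ((b + (1 + i) : ℕ) : ℚ) + 1 = ((i + 1 : ℕ) : ℚ) by push_cast; ring,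
      skip, if_neg (by positivity)]
    exact padicValRat.of_nat

/-- β (`1 ≤ a ≤ n ≤ a + J`): the valuation of the double-pole coefficient `B_a` as a signed sum of `v_p(N!)`. -/
theorem v_coef_beta {p : ℕ} [Fact p.Prime] (hp2 : p ≠ 2) (n J a : ℕ) (ha1 : 1 ≤ a) (ha : a ≤ n) (hn : n ≤ a + J) :
    padicValRat p (coef n J (-(a : ℚ)))
      = (vf p (2 * n) - vf p n) + ((vf p (2 * (a + J)) - vf p (a + J)) + (vf p (2 * (n - a)) - vf p (n - a)))
        - ((vf p (a + J - n) + vf p (n - a)) + (vf p (a - 1) + vf p (2 * n - a))) := by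
  unfold coef
  rw [padicValRat.div (mul_ne_zero (K0_ne n) (Nnum_neg_ne n J a)) (mul_ne_zero (D1_ne _ _ _) (D2_ne _ _)),
    padicValRat.mul (K0_ne n) (Nnum_neg_ne n J a), padicValRat.mul (D1_ne _ _ _) (D2_ne _ _),
    v_K0 hp2, v_Nnum_beta hp2 n J a ha, v_D1_beta n J a ha hn, v_D2_neg n a ha1 (by omega)]

/-- γ (`n < a ≤ 2n`): the valuation of the simple-pole coefficient `A_a` as a signed sum of `v_p(N!)`. -/
theorem v_coef_gamma {p : ℕ} [Fact p.Prime] (hp2 : p ≠ 2) (n J a : ℕ) (hna : n < a) (ha2 : a ≤ 2 * n) :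
    padicValRat p (coef n J (-(a : ℚ)))
      = (vf p (2 * n) - vf p n) + ((vf p (2 * (a + J)) - vf p (a + J)) - (vf p (2 * (a - n)) - vf p (a - n)))
        - ((vf p (a + J - n) - vf p (a - n - 1)) + (vf p (a - 1) + vf p (2 * n - a))) := by
  unfold coef
  rw [padicValRat.div (mul_ne_zero (K0_ne n) (Nnum_neg_ne n J a)) (mul_ne_zero (D1_ne _ _ _) (D2_ne _ _)),
    padicValRat.mul (K0_ne n) (Nnum_neg_ne n J a), padicValRat.mul (D1_ne _ _ _) (D2_ne _ _),
    v_K0 hp2, v_Nnum_gamma hp2 n J a hna, v_D1_gamma n J a hna, v_D2_neg n a (by omega) ha2]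

/-! ### Term valuations = the `vAlpha/vBeta/vGamma` factorial quotients of `CatalanRayDigits` + atoms -/

/-- β, `B`-part: `v_p(B_a t_{a−1} W(a)) = vBeta p n a (a+J) + v_p(W(a))` (when `W(a) ≠ 0`). -/
theorem v_termBB {p : ℕ} [Fact p.Prime] (hp2 : p ≠ 2) (n J a : ℕ) (ha1 : 1 ≤ a) (ha : a ≤ n) (hn : n ≤ a + J)
    (hW : Watom a ≠ 0) :
    padicValRat p (termBB n J a) = vBeta p n a (a + J) + padicValRat p (Watom a) := by
  unfold termBB
  rw [padicValRat.mul (coef_ne _ _ _ (Nnum_neg_ne n J a)) (mul_ne_zero (tB_ne a) hW), padicValRat.mul (tB_ne a) hW,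
    v_coef_beta hp2 n J a ha1 ha hn, v_tB hp2]
  unfold vBeta vf
  obtain ⟨r, rfl⟩ : ∃ r, n = a + r := ⟨n - a, by omega⟩
  rw [show a + r - a = r by omega, show 2 * (a + r) - 2 * a = 2 * r by omega]
  push_cast; ring

/-- β, `A′`-part: `v_p(B_a Λ_a · 2t_{a−1}σ(a)) = vBeta p n a (a+J) + v_p(Λ_a) + v_p(σ(a))` (when `Λ_a ≠ 0`). -/
theorem v_termBA {p : ℕ} [Fact p.Prime] (hp2 : p ≠ 2) (n J a : ℕ) (ha1 : 1 ≤ a) (ha : a ≤ n) (hn : n ≤ a + J)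
    (hL : logDer n J (-(a : ℚ)) ≠ 0) :
    padicValRat p (termBA n J a)
      = vBeta p n a (a + J) + padicValRat p (logDer n J (-(a : ℚ))) + padicValRat p (sigmaAtom a) := by
  unfold termBA
  have hσ : sigmaAtom a ≠ 0 := (sigmaAtom_pos a ha1).ne'
  have h2 : (2 : ℚ) * tB a * sigmaAtom a ≠ 0 := mul_ne_zero (mul_ne_zero two_ne_zero (tB_ne a)) hσ
  rw [padicValRat.mul (mul_ne_zero (coef_ne _ _ _ (Nnum_neg_ne n J a)) hL) h2,
    padicValRat.mul (coef_ne _ _ _ (Nnum_neg_ne n J a)) hL, padicValRat.mul (mul_ne_zero two_ne_zero (tB_ne a)) hσ,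
    padicValRat.mul two_ne_zero (tB_ne a), v_coef_beta hp2 n J a ha1 ha hn, v_tB hp2, v_two hp2]
  unfold vBeta vf
  obtain ⟨r, rfl⟩ : ∃ r, n = a + r := ⟨n - a, by omega⟩
  rw [show a + r - a = r by omega, show 2 * (a + r) - 2 * a = 2 * r by omega]
  push_cast; ring

/-- γ: `v_p(A_a · 2t_{a−1}σ(a)) = vGamma p n a (a+J) + v_p(σ(a))`. -/
theorem v_termG {p : ℕ} [Fact p.Prime] (hp2 : p ≠ 2) (n J a : ℕ) (hna : n < a) (ha2 : a ≤ 2 * n) :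
    padicValRat p (termG n J a) = vGamma p n a (a + J) + padicValRat p (sigmaAtom a) := by
  unfold termG
  have hσ : sigmaAtom a ≠ 0 := (sigmaAtom_pos a (by omega)).ne'
  rw [padicValRat.mul (coef_ne _ _ _ (Nnum_neg_ne n J a)) (mul_ne_zero (mul_ne_zero two_ne_zero (tB_ne a)) hσ),
    padicValRat.mul (mul_ne_zero two_ne_zero (tB_ne a)) hσ, padicValRat.mul two_ne_zero (tB_ne a),
    v_coef_gamma hp2 n J a hna ha2, v_tB hp2, v_two hp2]
  unfold vGamma vf
  obtain ⟨r, rfl⟩ : ∃ r, a = n + r + 1 := ⟨a - n - 1, by omega⟩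
  rw [show n + r + 1 - n - 1 = r by omega, show n + r + 1 - n = r + 1 by omega,
    show 2 * (n + r + 1) - 2 * n = 2 * (r + 1) by omega, show n + r + 1 - 1 = n + r by omega]
  push_cast; ring

/-! ### The `Λ_a` atom: `v_p(Λ_a) ≥ −⌊log_p(2X−1)⌋` -/

/-- `v_p(1/z) ≥ −⌊log_p B⌋` for an integer `|z| ≤ B` (`z = 0` gives `v_p(0) = 0`). -/
theorem v_inv_int_ge {p : ℕ} [Fact p.Prime] (z : ℤ) (B : ℕ) (hz : z.natAbs ≤ B) :
    -(Nat.log p B : ℤ) ≤ padicValRat p ((z : ℚ)⁻¹) := by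
  rcases eq_or_ne z 0 with rfl | hz0
  · simp
  · rw [padicValRat.inv, padicValRat.of_int, neg_le_neg_iff]
    unfold padicValInt
    have h1 : padicValNat p z.natAbs ≤ Nat.log p z.natAbs := padicValNat_le_nat_log _
    have h2 : Nat.log p z.natAbs ≤ Nat.log p B := Nat.log_mono_right hz
    exact_mod_cast h1.trans h2

/-- `v_p(2/z) ≥ −⌊log_p B⌋` for an integer `|z| ≤ B`, `p` odd. -/
theorem v_two_div_int_ge {p : ℕ} [Fact p.Prime] (hp2 : p ≠ 2) (z : ℤ) (B : ℕ) (hz : z.natAbs ≤ B) :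
    -(Nat.log p B : ℤ) ≤ padicValRat p (2 / (z : ℚ)) := by
  rcases eq_or_ne z 0 with rfl | hz0
  · simp
  · rw [div_eq_mul_inv, padicValRat.mul two_ne_zero (inv_ne_zero (by exact_mod_cast hz0)), v_two hp2, zero_add]
    exact v_inv_int_ge z B hz

/-- ultrametric inequality with a non-positive floor `k` (covers the case `x + y = 0`). -/
theorem le_padicValRat_add {p : ℕ} [Fact p.Prime] (x y : ℚ) (k : ℤ) (hk : k ≤ 0) (hx : k ≤ padicValRat p x)
    (hy : k ≤ padicValRat p y) : k ≤ padicValRat p (x + y) := by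
  rcases eq_or_ne (x + y) 0 with h | h
  · rw [h, padicValRat.zero]; exact hk
  · exact le_trans (le_min hx hy) (padicValRat.min_le_padicValRat_add h)

/-- ultrametric inequality for a difference with a non-positive floor `k`. -/
theorem le_padicValRat_sub {p : ℕ} [Fact p.Prime] (x y : ℚ) (k : ℤ) (hk : k ≤ 0) (hx : k ≤ padicValRat p x)
    (hy : k ≤ padicValRat p y) : k ≤ padicValRat p (x - y) := by
  rw [sub_eq_add_neg]
  exact le_padicValRat_add x (-y) k hk hx (by rwa [padicValRat.neg])

/-- **the `Λ` atom** (CATK1 L7 / CATK6 §3): for `1 ≤ a ≤ n`, `J ≥ 3n`, every summand of `Λ_a` is `±1/z` or `±2/z` with `z` an integer, `|z| ≤ 2X − 1` (`X = a + J`), hence `v_p(Λ_a) ≥ −⌊log_p(2X−1)⌋` for odd `p`. -/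
theorem logDer_padicValRat_ge {p : ℕ} [Fact p.Prime] (hp2 : p ≠ 2) (n J a : ℕ) (ha1 : 1 ≤ a) (ha : a ≤ n)
    (hJ : 3 * n ≤ J) :
    -(Nat.log p (2 * (a + J) - 1) : ℤ) ≤ padicValRat p (logDer n J (-(a : ℚ))) := by
  have hk : -(Nat.log p (2 * (a + J) - 1) : ℤ) ≤ 0 := neg_nonpos.mpr (by positivity)
  unfold logDer
  refine le_padicValRat_sub _ _ _ hk (le_padicValRat_sub _ _ _ hk ?_ ?_) ?_
  · refine le_padicValRat_sum _ _ _ hk (fun i hi => ?_)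
    rw [Finset.mem_range] at hi
    rw [show (-(a : ℚ) - J + 1 / 2 + (i : ℕ)) = (((2 * i + 1 - 2 * (a + J) : ℤ)) : ℚ) / 2 by push_cast; ring,
      inv_div]
    exact v_two_div_int_ge hp2 _ _ (by omega)
  · refine le_padicValRat_sum _ _ _ hk (fun i hi => ?_)
    rw [Finset.mem_range] at hi
    rw [show (-(a : ℚ) - J + n + (i : ℕ)) = (((i + n - (a + J) : ℤ)) : ℚ) by push_cast; ring]
    exact v_inv_int_ge _ _ (by omega)
  · refine le_padicValRat_sum _ _ _ hk (fun e he => ?_)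
    rw [Finset.mem_range] at he
    rw [show (-(a : ℚ) + (e : ℕ) + 1) = (((e + 1 - a : ℤ)) : ℚ) by push_cast; ring]
    exact v_inv_int_ge _ _ (by omega)

/-! ### Assembly: Theorem K6♭ for the explicit partial-fraction sum -/

/-- **`d*_{J+n} · d*_{max(J,4n−1)} · PClosed(n,J) ∈ ℤ[1/2]`** for `J ≥ 3n`, `n ≥ 1`: for every odd prime `p`,
`v_p(PClosed n J) ≥ −⌊log_p(J+n)⌋ − ⌊log_p max(J, 4n−1)⌋`.  On the rays `J = jn` (`j ≥ 3`) this is the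
odd-prime half of CATK6 Theorem K6 for the closed form `P_n = PClosed n (jn)` of the shifted representation. -/
theorem PClosed_oddInt (n J : ℕ) (hJ : 3 * n ≤ J) (hn : 1 ≤ n) (p : ℕ) [hp : Fact p.Prime] (hp2 : p ≠ 2) :
    -((Nat.log p (J + n) : ℤ) + Nat.log p (max J (4 * n - 1))) ≤ padicValRat p (PClosed n J) := by
  have hodd : p % 2 = 1 := hp.out.eq_two_or_odd.resolve_left hp2
  have hk : -((Nat.log p (J + n) : ℤ) + Nat.log p (max J (4 * n - 1))) ≤ 0 := neg_nonpos.mpr (by positivity)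
  unfold PClosed
  refine le_padicValRat_add _ _ _ hk (le_padicValRat_add _ _ _ hk ?_ ?_) ?_
  · -- family α
    refine le_padicValRat_sum _ _ _ hk (fun c hc => ?_)
    rw [Finset.mem_range] at hc
    rcases Nat.eq_zero_or_pos c with rfl | hc1
    · have h0 : termA n J 0 = 0 := by simp [termA, gsumAtom]
      rw [h0, padicValRat.zero]; exact hk
    · rcases eq_or_ne (gsumAtom c) 0 with hg | hg
      · rw [termA, hg, mul_zero, mul_zero, padicValRat.zero]; exact hk
      · obtain ⟨m, hm⟩ : ∃ m, J = m + c := ⟨J - c, by omega⟩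
        have h1 := termAlpha p n J c hJ hc1 (by omega)
        have h2 := gsumAtom_padicValRat_ge hp2 c
        have e : termA n J c = termA n (m + c) c := by rw [hm]
        rw [e, v_termA hp2 n m c (by omega) hg]
        rw [show J - c = m by omega] at h1
        linarith
  · -- family β
    refine le_padicValRat_sum _ _ _ hk (fun a ha => ?_)
    rw [Finset.mem_Icc] at ha
    refine le_padicValRat_add _ _ _ hk ?_ ?_
    · rcases eq_or_ne (Watom a) 0 with hW | hW
      · rw [termBB, hW, mul_zero, mul_zero, padicValRat.zero]; exact hk
      · have h1 := termBetaB p hodd n J a hJ ha.1 ha.2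
        have h2 := Watom_padicValRat_ge hp2 a
        rw [v_termBB hp2 n J a ha.1 ha.2 (by omega) hW]; linarith
    · rcases eq_or_ne (logDer n J (-(a : ℚ))) 0 with hL | hL
      · rw [termBA, hL, mul_zero, zero_mul, padicValRat.zero]; exact hk
      · have h1 := termBetaA p hodd n J a hJ ha.1 ha.2
        have h2 := sigmaAtom_padicValRat_ge hp2 a
        have h3 := logDer_padicValRat_ge hp2 n J a ha.1 ha.2 hJ
        rw [v_termBA hp2 n J a ha.1 ha.2 (by omega) hL]; linarith
  · -- family γ
    refine le_padicValRat_sum _ _ _ hk (fun a ha => ?_)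
    rw [Finset.mem_Icc] at ha
    have h1 := termGamma p hodd n J a hJ (by omega) ha.2
    have h2 := sigmaAtom_padicValRat_ge hp2 a
    rw [v_termG hp2 n J a (by omega) ha.2]; linarith

/-- The ray form: for `j ≥ 3`, `n ≥ 1` and every odd prime `p`,
`v_p(rayPClosed j n) ≥ −⌊log_p((j+1)n)⌋ − ⌊log_p max(jn, 4n−1)⌋`, i.e.
`d*_{(j+1)n} d*_{max(jn,4n−1)} · rayPClosed j n ∈ ℤ[1/2]` (CATK6 Theorem K6, odd part, for the closed form). -/
theorem rayPClosed_oddInt (j n : ℕ) (hj : 3 ≤ j) (hn : 1 ≤ n) (p : ℕ) [Fact p.Prime] (hp2 : p ≠ 2) :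
    -((Nat.log p ((j + 1) * n) : ℤ) + Nat.log p (max (j * n) (4 * n - 1))) ≤ padicValRat p (rayPClosed j n) := by
  have h := PClosed_oddInt n (j * n) (Nat.mul_le_mul_right n hj) hn p hp2
  rw [show j * n + n = (j + 1) * n by ring] at h
  exact h

end Summit.KontsevichZagierPeriods.Zeta5Search.Denom.CatalanRayPClosed
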